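import Summits.QuantumFields.YangMills.Theorems.LuscherReductionTwistedTraceScalingOneSiteShellGainPrelim
import HarnessLib

/-!
# ONE-SITE SHELL GAIN at a GENERAL inner radius: `qform_B(f,f) ≤ linkCE B·(1 − t√t/40)·‖f‖²` for `f` vanishing on `{‖zmCoord 1 U‖ < t}`, `B^{−1/5} ≤ t ≤ 1/5000`
# (lane A of S-BASE, crux `TwistedTraceScaling` stmt-QuantumFields-20203; sub-target C4-SHELL, design note `pub/ym-fleet/ym-luscher-20007-p1/COARSE-DESIGN.md` §22.4–§22.6)

Crux ONE's static valley bound `valley_qform_le_static` (B. Simon's semiclassical localisation away from the valley bottom, as a positive supersolution / Schur test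
for the one-site transfer kernel) was instantiated by ONE only at the inner radius `ρ₀ = √λ_b/2` (`…ValleyAsymp`, `valley_gain`).  The SHELL of the two-zone INNER analysis
(`…InnerTwoZone`: `InnerShellGainSmallAt`) needs it at every inner radius `t` down to the CORE radius `β^{−1/5}`, with a gain that dominates both `λ_b(L³β)` and the
second-order stiff correction `κt²`.  Part 2 of 2 (part 1 `…OneSiteShellGainPrelim` verifies the numerical hypotheses): the boundary term, the tenth root, and the assembly, for the parameter family (`v = √t`)
  `ρ₀ = v²`, `T = v/5`, `w = v⁴/1000`, `δ' = v⁴/10⁵`, `γ = v³/20`, `J = ⌊100/v³⌋₊`,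
valid for `B = u¹⁰`, `u ≥ 10⁴`, `u⁻¹ ≤ v ≤ 3/200`: the lower-shell gain is `(25/256)v³`, the errors `18ε₁ ≤ 0.018v³`, the upper-shell gain `v²/160 ≫ γ`, the far cap
`e^{−1/200000}` allows `γ ≤ 1.7·10⁻⁷`, `1/J ≤ v³/99`, and the boundary term `2e^{6B−Bw²} ≤ linkCE B·v³/200` (`x²⁴e^{−x} → 0`).  RESULT ★★ `oneSite_shell_gain`:
`∃ B₀, ∀ B ≥ B₀, ∀ t ∈ [B^{−1/5}, 1/5000]`, every bounded measurable `f` with `f = 0` on `{‖zmCoord 1 U‖ < t}` has `qform su2Rep B f f ≤ linkCE B·(1 − t√t/40)·l2 f f`.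
(Gain `t^{3/2}`: the supersolution uses the transverse Hessian over a kinetic length `T ≍ √t`.  For the SHELL at core exponent `s = 1/5`: `t√t ≥ β^{−3/10} ≫ λ_b ≍ β^{−1/3}` ✓,
and `t√t/40 ≥ 16κt²` for `t ≤ (640κ)⁻²` ✓.)
HONEST FRAMING: a one-site (L = 1) estimate; an ingredient of C4-SHELL of the CONDITIONAL fixed-lattice programme (route R2b1); not infinite volume, not a gap, not Clay.
-/

set_option autoImplicit false

noncomputable section

open MeasureTheory Filter Topology Real
open scoped Matrix Quaternion RealInnerProductSpace BigOperators
open Literature.MathematicalPhysics.QuantumFieldTheory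
open Literature.MathematicalPhysics.QuantumLattice
open Literature.Analysis.OperatorTheory.YMMatrixModel

namespace Summit.QuantumFields.YangMills.Theorems.FemtoTransferGap

namespace ShellAsymp

/-! ### §3. The exponentially small boundary term and the tenth root -/

/-- **Boundary term**: eventually in `u`, for every `v ≥ u⁻¹`, `2e^{6u¹⁰ − u¹⁰(v⁴/1000)²} ≤ linkCE(u¹⁰) · v³/200`. [folklore] -/
theorem tail_exp_le : ∃ u₁ : ℝ, ∀ u : ℝ, u₁ ≤ u → ∀ v : ℝ, u⁻¹ ≤ v →
    2 * Real.exp (6 * u ^ 10 - u ^ 10 * (v ^ 4 / 1000) ^ 2) ≤ linkCE (u ^ 10) * (v ^ 3 / 200) := by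
  set c : ℝ := Real.sqrt π ^ 9 / (800 * (2 * π ^ 2) ^ 3) with hc
  have hc0 : 0 < c := by rw [hc]; positivity
  have hc' : 0 < c / (10 : ℝ) ^ 144 := by positivity
  have hlim := (Real.tendsto_pow_mul_exp_neg_atTop_nhds_zero 24).eventually (eventually_le_nhds hc')
  obtain ⟨x₁, hx₁⟩ := Filter.eventually_atTop.1 hlim
  refine ⟨max 2 (1000000 * (|x₁| + 1)), fun u hu v huv => ?_⟩
  have hu2 : 2 ≤ u := le_trans (le_max_left _ _) hu
  have hux : 1000000 * (|x₁| + 1) ≤ u := le_trans (le_max_right _ _) hu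
  have hu0 : 0 < u := by linarith
  have hu1 : 1 ≤ u := by linarith
  have hui : 0 < u⁻¹ := inv_pos.2 hu0
  have hv0 : 0 < v := lt_of_lt_of_le hui huv
  -- `x = u²/10⁶ ≥ x₁`
  set x : ℝ := u ^ 2 / 1000000 with hxdef
  have hxx : x₁ ≤ x := by
    rw [hxdef, le_div_iff₀ (by norm_num)]
    have : u ≤ u ^ 2 := by nlinarith
    linarith [le_abs_self x₁]
  have hx0 : 0 ≤ x := by positivity
  have h1 := hx₁ x hxx
  -- `u⁴⁸ e^{−x} ≤ c`
  have hu48 : u ^ 48 * Real.exp (-x) ≤ c := by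
    have e : u ^ 48 = (10 : ℝ) ^ 144 * x ^ 24 := by rw [hxdef]; ring
    rw [e, mul_assoc]
    have := mul_le_mul_of_nonneg_left h1 (by positivity : (0 : ℝ) ≤ (10 : ℝ) ^ 144)
    rwa [mul_div_cancel₀ _ (by positivity : (10 : ℝ) ^ 144 ≠ 0)] at this
  -- the Gaussian lower bound for `linkCE`
  have hB0 : 0 < u ^ 10 := by positivity
  have hG := gauss_le_linkCE hB0
  have h27 : (1 : ℝ) / 2 ≤ 1 - 27 / u ^ 10 := by
    have h54 : (54 : ℝ) ≤ u ^ 10 := le_trans (by norm_num) (pow_le_pow_left₀ (by norm_num) hu2 10)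
    have : 27 / u ^ 10 ≤ 1 / 2 := by rw [div_le_iff₀ hB0]; linarith
    linarith
  have hsq : Real.sqrt (π / u ^ 10) = Real.sqrt π * (u ^ 5)⁻¹ := sqrt_div_pow_ten hu0 π Real.pi_pos.le
  have hGval : Real.exp (6 * u ^ 10) * Real.sqrt (π / u ^ 10) ^ 9 / (2 * π ^ 2) ^ 3
      = Real.exp (6 * u ^ 10) * Real.sqrt π ^ 9 * (u ^ 45)⁻¹ / (2 * π ^ 2) ^ 3 := by
    rw [hsq, mul_pow, ← inv_pow, ← pow_mul]; ring
  have hL : Real.exp (6 * u ^ 10) * Real.sqrt π ^ 9 * (u ^ 45)⁻¹ / (2 * π ^ 2) ^ 3 ≤ 2 * linkCE (u ^ 10) := by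
    rw [← hGval]
    have h0 : 0 ≤ Real.exp (6 * u ^ 10) * Real.sqrt (π / u ^ 10) ^ 9 / (2 * π ^ 2) ^ 3 := by positivity
    nlinarith
  -- monotonicity in `v`
  have h8 : (u⁻¹) ^ 8 ≤ v ^ 8 := pow_le_pow_left₀ hui.le huv 8
  have hexp_mono : Real.exp (6 * u ^ 10 - u ^ 10 * (v ^ 4 / 1000) ^ 2) ≤ Real.exp (6 * u ^ 10) * Real.exp (-x) := by
    rw [← Real.exp_add]
    refine Real.exp_le_exp.2 ?_
    have e1 : u ^ 10 * ((u⁻¹) ^ 4 / 1000) ^ 2 = x := by rw [hxdef]; field_simp; ring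
    have h2 : u ^ 10 * ((u⁻¹) ^ 4 / 1000) ^ 2 ≤ u ^ 10 * (v ^ 4 / 1000) ^ 2 := by
      have : ((u⁻¹) ^ 4 / 1000) ^ 2 ≤ (v ^ 4 / 1000) ^ 2 := by
        rw [div_pow, div_pow, ← pow_mul, ← pow_mul]; exact div_le_div_of_nonneg_right h8 (by positivity)
      exact mul_le_mul_of_nonneg_left this hB0.le
    linarith
  have h3 : (u⁻¹) ^ 3 ≤ v ^ 3 := pow_le_pow_left₀ hui.le huv 3
  have hE := Real.exp_pos (6 * u ^ 10)
  -- `e^{−x} ≤ c u^{−48}`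
  have hexp : Real.exp (-x) ≤ c * (u ^ 48)⁻¹ := by
    rw [le_mul_inv_iff₀ (by positivity)]; linarith
  have key : 2 * (Real.exp (6 * u ^ 10) * Real.exp (-x))
      ≤ (Real.exp (6 * u ^ 10) * Real.sqrt π ^ 9 * (u ^ 45)⁻¹ / (2 * π ^ 2) ^ 3) * ((u⁻¹) ^ 3 / 400) := by
    have := mul_le_mul_of_nonneg_left hexp hE.le
    have e2 : Real.exp (6 * u ^ 10) * (c * (u ^ 48)⁻¹)
        = (Real.exp (6 * u ^ 10) * Real.sqrt π ^ 9 * (u ^ 45)⁻¹ / (2 * π ^ 2) ^ 3) * ((u⁻¹) ^ 3 / 400) / 2 := by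
      rw [hc]; field_simp; ring
    rw [e2] at this
    linarith
  calc 2 * Real.exp (6 * u ^ 10 - u ^ 10 * (v ^ 4 / 1000) ^ 2)
      ≤ 2 * (Real.exp (6 * u ^ 10) * Real.exp (-x)) := by linarith
    _ ≤ (Real.exp (6 * u ^ 10) * Real.sqrt π ^ 9 * (u ^ 45)⁻¹ / (2 * π ^ 2) ^ 3) * ((u⁻¹) ^ 3 / 400) := key
    _ ≤ (2 * linkCE (u ^ 10)) * ((u⁻¹) ^ 3 / 400) := mul_le_mul_of_nonneg_right hL (by positivity)
    _ = linkCE (u ^ 10) * ((u⁻¹) ^ 3 / 200) := by ring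
    _ ≤ linkCE (u ^ 10) * (v ^ 3 / 200) := by
        refine mul_le_mul_of_nonneg_left ?_ (linkCE_pos hB0.le).le
        linarith

/-- `u = B^{1/10}`: `u¹⁰ = B`, lower bounds transfer, `B^{−1/5} = u⁻²`. [folklore] -/
theorem tenth_root_facts {B u₀ : ℝ} (hu₀ : 0 ≤ u₀) (hB : u₀ ^ 10 ≤ B) (hB0 : 0 < B) :
    B = (B ^ ((1 : ℝ) / 10)) ^ 10 ∧ u₀ ≤ B ^ ((1 : ℝ) / 10) ∧ B ^ (-(1 / 5 : ℝ)) = ((B ^ ((1 : ℝ) / 10))⁻¹) ^ 2 := by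
  have h10 : (B ^ ((1 : ℝ) / 10)) ^ 10 = B := by
    rw [← Real.rpow_natCast, ← Real.rpow_mul hB0.le]; norm_num
  refine ⟨h10.symm, ?_, ?_⟩
  · have : u₀ = (u₀ ^ 10) ^ ((1 : ℝ) / 10) := by
      rw [← Real.rpow_natCast, ← Real.rpow_mul hu₀]; norm_num
    rw [this]
    exact Real.rpow_le_rpow (by positivity) hB (by norm_num)
  · rw [← Real.rpow_neg hB0.le, ← Real.rpow_natCast, ← Real.rpow_mul hB0.le]
    norm_num

end ShellAsymp

/-! ### §4. The one-site shell gain -/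
set_option maxHeartbeats 400000 in
/-- ★★ **ONE-SITE SHELL GAIN at a general inner radius.**  There is `B₀` such that for `B ≥ B₀` and every radius `t` with `B^{−1/5} ≤ t ≤ 1/5000`, every bounded
measurable one-site function `f` vanishing on `{‖zmCoord 1 U‖ < t}` satisfies `qform_B(f,f) ≤ linkCE B · (1 − t√t/40) · ‖f‖²`.  (Crux ONE's static valley bound
`valley_qform_le_static` at `ρ₀ = t`, `T = √t/5`, `w = t²/1000`, `δ' = t²/10⁵`, `γ = t√t/20`, `J = ⌊100/(t√t)⌋`.) [cite: SimonB1983DiscreteSpectrum, §2] [cite: Luscher1983, §2] -/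
theorem oneSite_shell_gain : ∃ B₀ : ℝ, ∀ B : ℝ, B₀ ≤ B → ∀ t : ℝ, B ^ (-(1 / 5 : ℝ)) ≤ t → t ≤ 1 / 5000 →
    ∀ f : Cfg → ℝ, Measurable f → (∃ C : ℝ, ∀ U, |f U| ≤ C) → (∀ U, ‖zmCoord 1 U‖ < t → f U = 0) →
      qform su2Rep B f f ≤ linkCE B * (1 - t * Real.sqrt t / 40) * l2 f f := by
  obtain ⟨u₁, hu₁⟩ := ShellAsymp.tail_exp_le
  set u₀ : ℝ := max 10000 u₁ with hu₀
  have hu₀0 : 0 ≤ u₀ := le_trans (by norm_num) (le_max_left _ _)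
  refine ⟨u₀ ^ 10, fun B hB t htB ht f hfm hfb hf0 => ?_⟩
  have hB0 : 0 < B := by
    have h1 : (0 : ℝ) < 10000 ^ 10 := by positivity
    have h2 : (10000 : ℝ) ^ 10 ≤ u₀ ^ 10 := pow_le_pow_left₀ (by norm_num) (le_max_left _ _) 10
    linarith
  obtain ⟨hBu, hu, hfifth⟩ := ShellAsymp.tenth_root_facts hu₀0 hB hB0
  set u : ℝ := B ^ ((1 : ℝ) / 10) with hudef
  clear_value u
  have hu4 : 10000 ≤ u := le_trans (le_max_left _ _) hu
  have huu₁ : u₁ ≤ u := le_trans (le_max_right _ _) hu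
  have hu0 : 0 < u := by linarith
  subst hBu
  -- `v = √t`
  have ht0 : 0 < t := lt_of_lt_of_le (by rw [hfifth]; positivity) htB
  set v : ℝ := Real.sqrt t with hvdef
  have hv0 : 0 < v := Real.sqrt_pos.2 ht0
  have hvt : v ^ 2 = t := Real.sq_sqrt ht0.le
  have huv : u⁻¹ ≤ v := by
    rw [hfifth] at htB
    have := Real.sqrt_le_sqrt htB
    rwa [Real.sqrt_sq (inv_pos.2 hu0).le] at this
  have hv : v ≤ 3 / 200 := by
    by_contra hcon
    push Not at hcon
    have : (3 / 200 : ℝ) ^ 2 < v ^ 2 := by gcongr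
    rw [hvt] at this
    linarith
  -- the hypotheses of the static bound
  obtain ⟨hT, hw, hρ₀0, hρ₀w, hJ, hJw, hδ'0, hδ', hγ, hJinv⟩ := ShellAsymp.geom_hyps hu4 huv hv
  obtain ⟨hε₁, hε₂⟩ := ShellAsymp.eps_small hu4 huv hv
  have h1a := ShellAsymp.hyp_h1a hu4 huv hv
  have h1b := ShellAsymp.hyp_h1b hu4 huv hv
  have h2a := ShellAsymp.hyp_h2a hu4 huv hv
  have h2b := ShellAsymp.hyp_h2b hu4 huv hv
  have h2c := ShellAsymp.hyp_h2c hu4 huv hv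
  have h54 : (54 : ℝ) ≤ u ^ 10 := le_trans (by norm_num) (pow_le_pow_left₀ (by norm_num) (show (2 : ℝ) ≤ u by linarith) 10)
  have hf0' : ∀ U, ‖zmCoord 1 U‖ < v ^ 2 → f U = 0 := fun U hU => hf0 U (by rwa [hvt] at hU)
  have hstatic := valley_qform_le_static h54 (T := v / 5) (w := v ^ 4 / 1000) (ρ₀ := v ^ 2) (δ' := v ^ 4 / 100000) (γ := v ^ 3 / 20)
    (J := ⌊100 / v ^ 3⌋₊) hT hw hρ₀0 hρ₀w hJ hJw hδ'0 hδ' hε₁ hε₂ hγ h1a h1b h2a h2b h2c hfm hfb hf0'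
  have htail := hu₁ u huu₁ v huv
  -- assemble
  have hLpos : 0 < linkCE (u ^ 10) := linkCE_pos (by positivity)
  have hl2 : 0 ≤ l2 f f := by unfold l2; exact integral_nonneg fun U => mul_self_nonneg _
  have hJ' : linkCE (u ^ 10) / (⌊100 / v ^ 3⌋₊ : ℕ) ≤ linkCE (u ^ 10) * (v ^ 3 / 99) := by
    rw [div_eq_mul_one_div]
    exact mul_le_mul_of_nonneg_left hJinv hLpos.le
  have hv3 : v ^ 3 = t * v := by rw [← hvt]; ring
  have hcoef : linkCE (u ^ 10) * (1 - v ^ 3 / 20) + linkCE (u ^ 10) / (⌊100 / v ^ 3⌋₊ : ℕ) + 2 * Real.exp (6 * u ^ 10 - u ^ 10 * (v ^ 4 / 1000) ^ 2)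
      ≤ linkCE (u ^ 10) * (1 - t * Real.sqrt t / 40) := by
    rw [← hv3]; nlinarith [pow_pos hv0 3]
  exact hstatic.trans ((mul_le_mul_of_nonneg_right hcoef hl2))

end Summit.QuantumFields.YangMills.Theorems.FemtoTransferGap

end
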